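import Summits.BirchSwinnertonDyer.Rank1Residual.Iwasawa.NoFiniteSubmoduleOfSelfDualLayers
import Summits.BirchSwinnertonDyer.BirchSwinnertonDyer.Theorems.KatoDescentPotSupersingularSelmerInftyDirectLimit
import Literature.NumberTheory.EllipticCurves.IwasawaTowerTorsionProofs
import Literature.NumberTheory.EllipticCurves.IwasawaSelmerControlKernelProofs
import Literature.NumberTheory.EllipticCurves.IwasawaSelmerDualProofs
import Literature.NumberTheory.EllipticCurves.Greenberg1999.NoProperFiniteIndexSubmodule
import Literature.NumberTheory.EllipticCurves.MazurTorsionOrderValuationProofs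
import HarnessLib

/-!
# Route `ByReductionTypeAtTwo`, TOWER road (items 19271 / 19573 / 19922 / 19923): the PRINT binder `h414`
# (Greenberg, LNM 1716, Prop. 4.14 = `Greenberg1999.prop414_noFiniteSubmodule_of_not_dvd_torsionOrder`) REDUCED BY THE
# HACHIMORI–MATSUNO ROAD — «`X(E/K_∞)` has no non-zero finite `Λ`-submodule» from a Cassels–Tate layer package on the
# tree's OWN layers `Sel_{p^∞}(E/K_n)`, with injectivity (`E(K)[p] = 0`), transitions, exhaustion and the `Γ`-action
# DISCHARGED in the kernel

HONEST FRAMING (cell `bsd-2adic`, run/shared/lean/pub/bsd-2adic/, seat `bsd-2adic-tower-1` GEN 21, HUMAN RULINGS D-0036 /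
D-0054 / D-0074; D-0152: kernel hygiene on a CLASS-route hypothesis, no kit, no desk object): theorems only (no definition, no
named fact, no `sorry`, axioms the standard trio); CONDITIONAL on the displayed package; closes no route item; nothing booked;
BSD is not proved by any of this. `h414` is displayed on 429 K4 TOWER / λ-rank door and class files
(`…TowerLambdaRank.le_lambda_of_towerGap_of_towerRank`, `…TowerClass*`); this file records in the kernel WHICH inputs of
Hachimori–Matsuno's proof of it remain genuinely in print, for the tree's plain Selmer tower.

WHAT IT PROVES. Hachimori–Matsuno (Proc. AMS 128 (2000), Theorem, Cor. (i)) prove Greenberg's Prop. 4.14 — `X = Sel_{p^∞}(E/K_∞)^∨`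
`Λ`-torsion and `E(K)[p] = 0` ⟹ `X` has no non-zero finite `Λ`-submodule — from: (a) the kernels
`X_n = ker(Sel(E/K_n) → Sel(E/K_∞)^{Γ_n})` vanish when `E(K)[p] = 0` (Manin Lem. 4.4(a) / Greenberg Lem. 3.1 with
`E(K_∞)[p^∞] = 0`, `Γ` pro-`p`); (b) the maximal divisible subgroups `D_n ⊆ Sel(E/K_n)` stabilise (`X` torsion); (c) the
Cassels–Tate pairing on `C_n = Sel(E/K_n)/D_n` (Milne *ADT* I §6) is non-degenerate, skew-symmetric, Galois-equivariant, with
restriction adjoint to corestriction; (d) Washington's norm argument (Prop. 13.28). The tree holds (d) and the whole assembly as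
ONE abstract kernel theorem over abstract layers (`Rank1Residual.Iwasawa.forall_finite_eq_bot_of_selfDualLayers`, cell `bsd-potss`).
THIS FILE instantiates it on the tree's PLAIN Selmer tower `W.selmerLayer κ n →(layerToInfty)→ W.selmerInfty κ` for ANY number
field `K`, ANY `ℤ_p`-extension `κ` with topological generator `γ`, ANY Pontryagin-dual datum `D : W.SelmerDualData κ γ`, and
DISCHARGES in the kernel every clause that is not (b)/(c): injectivity of the layers from `E(K)[p] = 0`
(`fixedPoints_kerSubgroup_geomPrimaryTorsion_eq_bot` + Greenberg's Lemma 3.1 bound `finite_ker_layerToInfty_and_card_le`),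
the transitions `res_{K_{n+1}/K_n}` (`resOfLe_mem_selmerGroupOver`, `resOfLe_comp`), the exhaustion
`Sel(E/K_∞) = ⋃ res Sel(E/K_n)` (`FineSelmerLeSignedSelmer.mem_selmerInfty_iff_exists_layer`), the `Γ`-action on the layers
(`map_conjH1_selmerGroupOver_le`, `resOfLe_comp_conjH1`, `conjH1_mul`/`conjH1_one`) and the `Λ`-structure of the dual
(`D.toDual_T_smul`, `D.bijective`). What stays DISPLAYED is exactly (b) + (c), pinned to the tree's maps by their values:
corestrictions `Sel(E/K_{n+1}) → Sel(E/K_n)` realising the norm `Σ_{i<p} conj_{γ^{pⁿ i}}` in `H¹(K_∞, E[p^∞])`, `p`-divisible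
`conj_γ`-stable subgroups `D_n ≤ Sel(E/K_n)` with `res(D_{n+1}) ⊆ res(D_n)` for `n ≥ m`, and biadditive `conj_γ`-invariant pairings
on `Sel(E/K_n)` with right kernel exactly `D_n`, representing every character of `Sel(E/K_n)/D_n`, res/cores-adjoint.

* §1 `SelmerDualData.forall_finite_eq_bot_of_layerPackage` — abstract layers over `Sel_{p^∞}(E/K_∞)` (mirror of the potss
  signed statement `StrictSignedSelmerDualData.forall_finite_eq_bot_of_layerPackage`).
* §2 `SelmerDualData.forall_finite_eq_bot_of_towerPackage` — the tree's layers; only (b)+(c) displayed; `E(K)[p] = 0` as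
  `∀ P : W.toAffine.Point, p • P = 0 → P = 0`.
* §3 `prop414_of_towerPackages` — over `ℚ`: the Literature named fact `prop414_noFiniteSubmodule_of_not_dvd_torsionOrder`
  (binder `h414`) FOLLOWS from the displayed Cassels–Tate tower packages (`¬ p ∣ #E(ℚ)_tors` ⟹ `E(ℚ)[p] = 0` by Lagrange); the
  torsion / finite-generation hypotheses of the fact are not even used beyond the package's stabilisation clause.

References: [HachimoriMatsuno2000] Theorem, Cor. (i) (p. 2540) and its proof; [GreenbergLNM1716] §3 Lemma 3.1 (p. 86), §4
Prop. 4.14 (pp. 104–105: "a rather different proof … has been found by Hachimori and Matsuno … based on the Cassels–Tate pairing");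
[MilneADT2006] I Prop. 6.9, Thm. 6.13, Rem. 6.10; [Washington1997] Prop. 13.28; [KitajimaOtsuki2018] Lemma 3.30 (2), Prop. 4.1.
-/

set_option autoImplicit false
-- the Theorems namespace of this sub repeats the summit name by design (D-0017 nested layout: Summit.<S>.<Sub>)
set_option linter.dupNamespace false

noncomputable section

open scoped Classical

universe u

namespace Summit.BirchSwinnertonDyer.BirchSwinnertonDyer.Theorems.TowerHaMa

open NumberField IsDedekindDomain Field WeierstrassCurve Literature.NumberTheory.EllipticCurves
  Literature.NumberTheory.EllipticCurves.ZpExtension Literature.NumberTheory.GaloisRepresentations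
  Summit.BirchSwinnertonDyer.Rank1Residual

/-! ## §1 Any Pontryagin-dual datum of `Sel_{p^∞}(E/K_∞)`: no finite `Λ`-submodule from an abstract layer package -/

/-- **`X(E/K_∞)` has no non-zero finite `Λ`-submodule, given a Hachimori–Matsuno layer package on `Sel_{p^∞}(E/K_∞)`** — for
ANY number field `K`, `ℤ_p`-extension `κ`, `γ ∈ Γ_K` and ANY dual datum `D : W.SelmerDualData κ γ`. The package (displayed,
existential over abstract layer data `L_n →(r_n)→ Sel_∞`): injective layers with transitions over `Sel_∞`, exhausting it, with a
surjective action `γL_n` over `conj_γ`; res ∘ cores = norm, adjoint to the transition; `p`-divisible `γL_n`-stable `D_n` with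
`r_{n+1}(D_{n+1}) ⊆ r_n(D_n)` (`n ≥ m`); `γL_n`-invariant pairings with right kernel `D_n` representing every character of
`L_n/D_n`. Then `D.toDual` (injective, `T ↦ conj_γ − 1`) feeds `Rank1Residual.Iwasawa.forall_finite_eq_bot_of_selfDualLayers`.
[cite: HachimoriMatsuno2000, Theorem and Corollary (i) (p. 2540)] [cite: KitajimaOtsuki2018, Lemma 3.30 (2), Prop. 4.1] -/
theorem SelmerDualData.forall_finite_eq_bot_of_layerPackage
    {K : Type u} [Field K] [NumberField K] {W : WeierstrassCurve K} {p : ℕ} [Fact p.Prime]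
    {κ : ZpExtension K p} {γ : Field.absoluteGaloisGroup K} (D : W.SelmerDualData κ γ)
    (hpack : ∃ (L : ℕ → Type u) (_ : ∀ n, AddCommGroup (L n))
        (r : ∀ n, L n →+ W.selmerInfty κ) (ι : ∀ n, L n →+ L (n + 1))
        (γL : ∀ n, L n →+ L n) (Dn : ∀ n, AddSubgroup (L n))
        (pair : ∀ n, L n →+ L n →+ AddCircle (1 : ℚ)) (m : ℕ),
      (∀ n, Function.Injective (r n)) ∧
      (∀ n (x : L n), r (n + 1) (ι n x) = r n x) ∧
      (∀ s : W.selmerInfty κ, ∃ n, ∃ x : L n, r n x = s) ∧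
      (∀ n (x : L n), r n (γL n x) = W.conjSelmerInfty κ γ (r n x)) ∧
      (∀ n, Function.Surjective (γL n)) ∧
      (∀ n (t : L (n + 1)), ∃ t' : L n,
        r n t' = ∑ i ∈ Finset.range p, ((W.conjSelmerInfty κ γ) ^ (p ^ n * i)) (r (n + 1) t) ∧
        ∀ y : L n, pair n y t' = pair (n + 1) (ι n y) t) ∧
      (∀ n, ∀ d ∈ Dn n, ∃ d' ∈ Dn n, p • d' = d) ∧
      (∀ n, ∀ d ∈ Dn n, γL n d ∈ Dn n) ∧
      (∀ n, m ≤ n → (Dn (n + 1)).map (r (n + 1)) ≤ (Dn n).map (r n)) ∧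
      (∀ n (t : L n), (∀ y : L n, pair n y t = 0) → t ∈ Dn n) ∧
      (∀ n, ∀ t ∈ Dn n, ∀ y : L n, pair n y t = 0) ∧
      (∀ n (g : L n →+ AddCircle (1 : ℚ)), (∀ d ∈ Dn n, g d = 0) →
        ∃ c : L n, ∀ y : L n, g y = pair n y c) ∧
      (∀ n (y t : L n), pair n (γL n y) (γL n t) = pair n y t)) :
    ∀ M : Submodule (IwasawaAlgebra p) D.X, Finite M → M = ⊥ := by
  obtain ⟨L, instL, r, ι, γL, Dn, pair, m, hr, hι, hex, hγL, hγLs, hcores, hDdiv, hDγ, hDst, hker,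
    hD0, hsurj, hinv⟩ := hpack
  exact Iwasawa.forall_finite_eq_bot_of_selfDualLayers p (W.conjSelmerInfty κ γ) r ι
    γL Dn pair D.toDual hr hι hex hγL hγLs hcores hDdiv hDγ m hDst hker hD0 hsurj hinv D.bijective.1
    fun x s ↦ D.toDual_T_smul x s

/-! ## §2 The tree's own layers `Sel_{p^∞}(E/K_n)`: injectivity, transitions, exhaustion, `Γ`-action DISCHARGED -/

section Tower

variable {K : Type u} [Field K] [NumberField K] (W : WeierstrassCurve K) [W.IsElliptic] {p : ℕ} [Fact p.Prime]
  (κ : ZpExtension K p) {γ : Field.absoluteGaloisGroup K}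

/-- **Manin's Lemma 4.4(a) / Greenberg's Lemma 3.1 with `E(K)[p] = 0`, every layer**: the restrictions
`h_n : H¹(K_n, E[p^∞]) → H¹(K_∞, E[p^∞])` (`layerToInfty κ n`) are injective for every `n` when `E(K)` has no point of order `p`
(`E(K_∞)[p^∞] = 0` because `Γ` is pro-`p`, `fixedPoints_kerSubgroup_geomPrimaryTorsion_eq_bot`; then
`#ker h_n ≤ #(B/(γ^{pⁿ}−1)B) = 1`, `finite_ker_layerToInfty_and_card_le`). Hachimori–Matsuno's «`X_n = 0` for all `n`».
[cite: GreenbergLNM1716, §3 Lemma 3.1 (p. 86)] [cite: HachimoriMatsuno2000, proof of the Corollary, case (i) (p. 2540)] -/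
theorem layerToInfty_injective_of_no_pTorsion (hγ : κ.IsTopGenerator γ)
    (hK : ∀ P : W.toAffine.Point, p • P = 0 → P = 0) (n : ℕ) :
    Function.Injective (W.layerToInfty κ n) := by
  have hB := W.fixedPoints_kerSubgroup_geomPrimaryTorsion_eq_bot κ hK
  haveI hsub : Subsingleton (FixedPoints.addSubgroup κ.kerSubgroup (W.geomPrimaryTorsion p)) := by
    rw [hB]; infer_instance
  haveI hfinQ : Finite (FixedPoints.addSubgroup κ.kerSubgroup (geomPrimaryTorsion W p) ⧸
      (ResKernel.subOne κ.kerSubgroup (geomPrimaryTorsion W p) (γ ^ p ^ n)).range) :=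
    Finite.of_surjective _ (QuotientAddGroup.mk'_surjective _)
  have hcardQ : Nat.card (FixedPoints.addSubgroup κ.kerSubgroup (geomPrimaryTorsion W p) ⧸
      (ResKernel.subOne κ.kerSubgroup (geomPrimaryTorsion W p) (γ ^ p ^ n)).range) ≤ 1 := by
    rw [Finite.card_le_one_iff_subsingleton]
    refine ⟨fun a b ↦ ?_⟩
    obtain ⟨a, rfl⟩ := QuotientAddGroup.mk'_surjective _ a
    obtain ⟨b, rfl⟩ := QuotientAddGroup.mk'_surjective _ b
    rw [Subsingleton.elim a b]
  obtain ⟨hfin, hle⟩ := W.finite_ker_layerToInfty_and_card_le κ hγ n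
  haveI := hfin
  haveI : Subsingleton (W.layerToInfty κ n).ker := Finite.card_le_one_iff_subsingleton.mp (hle.trans hcardQ)
  rw [← AddMonoidHom.ker_eq_bot_iff]
  exact (W.layerToInfty κ n).ker.eq_bot_of_subsingleton

/-- **Hachimori–Matsuno on the tree's plain Selmer tower — only the Cassels–Tate layer package displayed.** For ANY number field
`K`, elliptic `W/K` with `E(K)[p] = 0` (`hK`), ANY `ℤ_p`-extension `κ` with topological generator `γ`, ANY dual datum
`D : W.SelmerDualData κ γ`: if the layers `Sel_{p^∞}(E/K_n)` (`W.selmerLayer κ n`) carry (b) `p`-divisible `conj_γ`-stable subgroups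
`D_n` whose restrictions to `K_∞` stop growing from some `m` on, and (c) biadditive `conj_γ`-invariant pairings with right kernel
exactly `D_n`, representing every character of `Sel(E/K_n)/D_n`, together with corestrictions `Sel(E/K_{n+1}) → Sel(E/K_n)`
realising the norm `Σ_{i<p} conj_{γ^{pⁿ i}}` after restriction to `K_∞` and adjoint to `res_{K_{n+1}/K_n}` — all pinned to the
tree's maps `layerToInfty`, `resOfLe`, `conjH1` by their values — then `D.X` has no non-zero finite `Λ`-submodule. Injectivity
(`layerToInfty_injective_of_no_pTorsion`), transitions, exhaustion (`mem_selmerInfty_iff_exists_layer`) and the `Γ`-action are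
supplied HERE; (b)+(c) are Hachimori–Matsuno's printed inputs (cofinite generation + stabilisation from `Λ`-torsion; Milne
*ADT* I §6 for the pairing). [cite: HachimoriMatsuno2000, Theorem and Corollary (i) (p. 2540)]
[cite: MilneADT2006, I Prop. 6.9, Thm. 6.13 (a)(b), Rem. 6.10] [cite: GreenbergLNM1716, §4 Prop. 4.14 (pp. 104–105)] -/
theorem SelmerDualData.forall_finite_eq_bot_of_towerPackage (hγ : κ.IsTopGenerator γ)
    (hK : ∀ P : W.toAffine.Point, p • P = 0 → P = 0) (D : W.SelmerDualData κ γ)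
    (Dn : ∀ n, AddSubgroup (W.selmerLayer κ n))
    (pair : ∀ n, W.selmerLayer κ n →+ W.selmerLayer κ n →+ AddCircle (1 : ℚ)) (m : ℕ)
    (hcores : ∀ n (t : W.selmerLayer κ (n + 1)), ∃ t' : W.selmerLayer κ n,
      W.layerToInfty κ n t' =
        ∑ i ∈ Finset.range p, W.conjH1 p κ.kerSubgroup (γ ^ (p ^ n * i)) (W.layerToInfty κ (n + 1) t) ∧
      ∀ (y : W.selmerLayer κ n) (y' : W.selmerLayer κ (n + 1)),
        (y' : W.subgroupH1 p (κ.layerSubgroup (n + 1))) =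
          W.resOfLe p (κ.layerSubgroup_antitone (Nat.le_succ n)) y → pair n y t' = pair (n + 1) y' t)
    (hDdiv : ∀ n, ∀ d ∈ Dn n, ∃ d' ∈ Dn n, p • d' = d)
    (hDγ : ∀ n (d d' : W.selmerLayer κ n), d ∈ Dn n →
      (d' : W.subgroupH1 p (κ.layerSubgroup n)) = W.conjH1 p (κ.layerSubgroup n) γ d → d' ∈ Dn n)
    (hDst : ∀ n, m ≤ n → ∀ d ∈ Dn (n + 1), ∃ d₀ ∈ Dn n,
      W.layerToInfty κ (n + 1) (d : W.subgroupH1 p (κ.layerSubgroup (n + 1))) = W.layerToInfty κ n d₀)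
    (hker : ∀ n (t : W.selmerLayer κ n), (∀ y, pair n y t = 0) → t ∈ Dn n)
    (hD0 : ∀ n, ∀ t ∈ Dn n, ∀ y, pair n y t = 0)
    (hsurj : ∀ n (g : W.selmerLayer κ n →+ AddCircle (1 : ℚ)), (∀ d ∈ Dn n, g d = 0) →
      ∃ c, ∀ y, g y = pair n y c)
    (hinv : ∀ n (y t y' t' : W.selmerLayer κ n),
      (y' : W.subgroupH1 p (κ.layerSubgroup n)) = W.conjH1 p (κ.layerSubgroup n) γ y →
      (t' : W.subgroupH1 p (κ.layerSubgroup n)) = W.conjH1 p (κ.layerSubgroup n) γ t → pair n y' t' = pair n y t) :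
    ∀ M : Submodule (IwasawaAlgebra p) D.X, Finite M → M = ⊥ := by
  -- the tree's layer data as additive maps
  let r : ∀ n, W.selmerLayer κ n →+ W.selmerInfty κ := fun n ↦
    ((W.layerToInfty κ n).comp (W.selmerLayer κ n).subtype).codRestrict (W.selmerInfty κ)
      fun x ↦ W.map_layerToInfty_selmerLayer_le_holds κ n ⟨x, x.2, rfl⟩
  have hr_coe : ∀ n (x : W.selmerLayer κ n),
      ((r n x : W.selmerInfty κ) : W.subgroupH1 p κ.kerSubgroup) = W.layerToInfty κ n x := fun _ _ ↦ rfl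
  let ι : ∀ n, W.selmerLayer κ n →+ W.selmerLayer κ (n + 1) := fun n ↦
    ((W.resOfLe p (κ.layerSubgroup_antitone (Nat.le_succ n))).comp (W.selmerLayer κ n).subtype).codRestrict
      (W.selmerLayer κ (n + 1)) fun x ↦ W.resOfLe_mem_selmerGroupOver p _ x.2
  have hι_coe : ∀ n (x : W.selmerLayer κ n), ((ι n x : W.selmerLayer κ (n + 1)) : W.subgroupH1 p (κ.layerSubgroup (n + 1))) =
      W.resOfLe p (κ.layerSubgroup_antitone (Nat.le_succ n)) x := fun _ _ ↦ rfl
  let γL : ∀ n, W.selmerLayer κ n →+ W.selmerLayer κ n := fun n ↦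
    ((W.conjH1 p (κ.layerSubgroup n) γ).comp (W.selmerLayer κ n).subtype).codRestrict (W.selmerLayer κ n)
      fun x ↦ W.map_conjH1_selmerGroupOver_le_holds p (κ.layerSubgroup n) γ ⟨x, x.2, rfl⟩
  have hγL_coe : ∀ n (x : W.selmerLayer κ n), ((γL n x : W.selmerLayer κ n) : W.subgroupH1 p (κ.layerSubgroup n)) =
      W.conjH1 p (κ.layerSubgroup n) γ x := fun _ _ ↦ rfl
  -- (a) injective layers
  have hr : ∀ n, Function.Injective (r n) := fun n x y h ↦
    Subtype.ext (layerToInfty_injective_of_no_pTorsion W κ hγ hK n (by rw [← hr_coe, ← hr_coe, h]))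
  -- transitions over `Sel_∞`
  have hι : ∀ n (x : W.selmerLayer κ n), r (n + 1) (ι n x) = r n x := fun n x ↦ by
    apply Subtype.ext
    rw [hr_coe, hr_coe, hι_coe]
    exact congrArg (fun f ↦ f (x : W.subgroupH1 p (κ.layerSubgroup n)))
      (W.resOfLe_comp_holds p (κ.kerSubgroup_le_layerSubgroup (n + 1)) (κ.layerSubgroup_antitone (Nat.le_succ n)))
  -- exhaustion
  have hex : ∀ s : W.selmerInfty κ, ∃ n, ∃ x : W.selmerLayer κ n, r n x = s := fun s ↦ by
    obtain ⟨n, y, hy, hys⟩ := (FineSelmerLeSignedSelmer.mem_selmerInfty_iff_exists_layer W κ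
      (s : W.subgroupH1 p κ.kerSubgroup)).mp s.2
    exact ⟨n, ⟨y, hy⟩, Subtype.ext hys⟩
  -- the `Γ`-action on the layers over `conj_γ`
  have hγL : ∀ n (x : W.selmerLayer κ n), r n (γL n x) = W.conjSelmerInfty κ γ (r n x) := fun n x ↦ by
    apply Subtype.ext
    rw [hr_coe, coe_conjSelmerInfty_apply, hr_coe, hγL_coe]
    exact congrArg (fun f ↦ f (x : W.subgroupH1 p (κ.layerSubgroup n)))
      (resOfLe_comp_conjH1_holds (M := geomPrimaryTorsion W p) (κ.kerSubgroup_le_layerSubgroup n) γ)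
  have hγLs : ∀ n, Function.Surjective (γL n) := fun n y ↦ by
    refine ⟨⟨W.conjH1 p (κ.layerSubgroup n) γ⁻¹ y,
      W.map_conjH1_selmerGroupOver_le_holds p (κ.layerSubgroup n) γ⁻¹ ⟨y, y.2, rfl⟩⟩, Subtype.ext ?_⟩
    rw [hγL_coe]
    change ((W.conjH1 p (κ.layerSubgroup n) γ).comp (W.conjH1 p (κ.layerSubgroup n) γ⁻¹)) _ = _
    rw [← W.conjH1_mul_holds p (κ.layerSubgroup n) γ γ⁻¹, mul_inv_cancel, W.conjH1_one_holds p (κ.layerSubgroup n),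
      AddMonoidHom.id_apply]
  -- the displayed package, transported to the abstract shape
  have hcores' : ∀ n (t : W.selmerLayer κ (n + 1)), ∃ t' : W.selmerLayer κ n,
      r n t' = ∑ i ∈ Finset.range p, ((W.conjSelmerInfty κ γ) ^ (p ^ n * i)) (r (n + 1) t) ∧
      ∀ y : W.selmerLayer κ n, pair n y t' = pair (n + 1) (ι n y) t := fun n t ↦ by
    obtain ⟨t', ht', hadj⟩ := hcores n t
    refine ⟨t', Subtype.ext ?_, fun y ↦ hadj y (ι n y) (hι_coe n y)⟩
    rw [hr_coe, ht', AddSubmonoidClass.coe_finsetSum]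
    exact Finset.sum_congr rfl fun i _ ↦ (W.coe_conjSelmerInfty_pow_apply κ γ (p ^ n * i) (r (n + 1) t)).symm
  have hDγ' : ∀ n, ∀ d ∈ Dn n, γL n d ∈ Dn n := fun n d hd ↦ hDγ n d (γL n d) hd (hγL_coe n d)
  have hDst' : ∀ n, m ≤ n → (Dn (n + 1)).map (r (n + 1)) ≤ (Dn n).map (r n) := by
    rintro n hn _ ⟨d, hd, rfl⟩
    obtain ⟨d₀, hd₀, h⟩ := hDst n hn d hd
    exact ⟨d₀, hd₀, Subtype.ext (by rw [hr_coe, hr_coe]; exact h.symm)⟩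
  have hinv' : ∀ n (y t : W.selmerLayer κ n), pair n (γL n y) (γL n t) = pair n y t :=
    fun n y t ↦ hinv n y t (γL n y) (γL n t) (hγL_coe n y) (hγL_coe n t)
  exact SelmerDualData.forall_finite_eq_bot_of_layerPackage D
    ⟨fun n ↦ ↥(W.selmerLayer κ n), inferInstance, r, ι, γL, Dn, pair, m, hr, hι, hex, hγL, hγLs, hcores', hDdiv, hDγ',
      hDst', hker, hD0, hsurj, hinv'⟩

end Tower

/-! ## §3 Over `ℚ`: the binder `h414` from the displayed Cassels–Tate tower packages -/

/-- **`h414` by the Hachimori–Matsuno road.** If, for every globally minimal elliptic `W/ℚ`, every prime `p` with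
`p ∤ #E(ℚ)_tors`, every cyclotomic `κ` with topological generator `γ`, the plain Selmer tower `Sel_{p^∞}(E/ℚ_n)` carries the
Cassels–Tate layer package of §2 (displayed: Hachimori–Matsuno's inputs (b) stabilised divisible parts, (c) the Cassels–Tate
pairings with res/cores adjointness — Milne *ADT* I §6), then the Literature named fact
`Greenberg1999.prop414_noFiniteSubmodule_of_not_dvd_torsionOrder` (Greenberg LNM 1716 Prop. 4.14, `F = ℚ`; the PRINT binder
`h414` of the K4 TOWER doors) HOLDS — with injectivity of the layers, transitions, exhaustion and the `Γ`-action proved in the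
kernel (`p ∤ #E(ℚ)_tors` ⟹ `E(ℚ)[p] = 0`, Lagrange: `dvd_torsionOrder_of_nsmul_eq_zero`). CONDITIONAL; nothing asserted about
any curve. [cite: HachimoriMatsuno2000, Theorem and Corollary (i) (p. 2540)] [cite: GreenbergLNM1716, §4 Prop. 4.14 (pp. 104–105)]
[cite: MilneADT2006, I Prop. 6.9, Thm. 6.13, Rem. 6.10] -/
theorem prop414_of_towerPackages
    (hpack : ∀ (W : WeierstrassCurve ℚ) [W.IsElliptic] [W.IsGloballyMinimal] (p : ℕ) [Fact p.Prime],
      ¬ p ∣ W.torsionOrder →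
      ∀ (κ : ZpExtension ℚ p) (γ : Field.absoluteGaloisGroup ℚ), κ.IsCyclotomic → κ.IsTopGenerator γ →
      ∃ (Dn : ∀ n, AddSubgroup (W.selmerLayer κ n))
        (pair : ∀ n, W.selmerLayer κ n →+ W.selmerLayer κ n →+ AddCircle (1 : ℚ)) (m : ℕ),
      (∀ n (t : W.selmerLayer κ (n + 1)), ∃ t' : W.selmerLayer κ n,
        W.layerToInfty κ n t' =
          ∑ i ∈ Finset.range p, W.conjH1 p κ.kerSubgroup (γ ^ (p ^ n * i)) (W.layerToInfty κ (n + 1) t) ∧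
        ∀ (y : W.selmerLayer κ n) (y' : W.selmerLayer κ (n + 1)),
          (y' : W.subgroupH1 p (κ.layerSubgroup (n + 1))) =
            W.resOfLe p (κ.layerSubgroup_antitone (Nat.le_succ n)) y → pair n y t' = pair (n + 1) y' t) ∧
      (∀ n, ∀ d ∈ Dn n, ∃ d' ∈ Dn n, p • d' = d) ∧
      (∀ n (d d' : W.selmerLayer κ n), d ∈ Dn n →
        (d' : W.subgroupH1 p (κ.layerSubgroup n)) = W.conjH1 p (κ.layerSubgroup n) γ d → d' ∈ Dn n) ∧
      (∀ n, m ≤ n → ∀ d ∈ Dn (n + 1), ∃ d₀ ∈ Dn n,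
        W.layerToInfty κ (n + 1) (d : W.subgroupH1 p (κ.layerSubgroup (n + 1))) = W.layerToInfty κ n d₀) ∧
      (∀ n (t : W.selmerLayer κ n), (∀ y, pair n y t = 0) → t ∈ Dn n) ∧
      (∀ n, ∀ t ∈ Dn n, ∀ y, pair n y t = 0) ∧
      (∀ n (g : W.selmerLayer κ n →+ AddCircle (1 : ℚ)), (∀ d ∈ Dn n, g d = 0) → ∃ c, ∀ y, g y = pair n y c) ∧
      (∀ n (y t y' t' : W.selmerLayer κ n),
        (y' : W.subgroupH1 p (κ.layerSubgroup n)) = W.conjH1 p (κ.layerSubgroup n) γ y →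
        (t' : W.subgroupH1 p (κ.layerSubgroup n)) = W.conjH1 p (κ.layerSubgroup n) γ t → pair n y' t' = pair n y t)) :
    Greenberg1999.prop414_noFiniteSubmodule_of_not_dvd_torsionOrder := by
  intro W _ _ p _ htors κ γ hκ hγ D _ _ N hN
  obtain ⟨Dn, pair, m, hcores, hDdiv, hDγ, hDst, hker, hD0, hsurj, hinv⟩ := hpack W p htors κ γ hκ hγ
  refine SelmerDualData.forall_finite_eq_bot_of_towerPackage W κ hγ (fun P hP ↦ ?_) D Dn pair m hcores hDdiv hDγ hDst
    hker hD0 hsurj hinv N hN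
  -- `p ∤ #E(ℚ)_tors` ⟹ no rational point of order `p` (Lagrange in `E(ℚ)_tors`)
  by_contra hP0
  exact htors (dvd_torsionOrder_of_nsmul_eq_zero W p (by convert hP) hP0)

end Summit.BirchSwinnertonDyer.BirchSwinnertonDyer.Theorems.TowerHaMa

end
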